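import Mathlib
import HarnessLib
import Literature.Combinatorics.AssociationSchemes.Basic
import Summits.MatrixMultiplication.MatrixMultiplication.Theses.CommutativeSchemes
import Summits.MatrixMultiplication.MatrixMultiplication.Theorems.CommutativeSchemesCommutativeRealizationStubTranslationSchemeIsCommutative
import Summits.MatrixMultiplication.MatrixMultiplication.Theorems.CommutativeSchemesCommutativeRealizationStubCommutativeRealizationCube

/-!
# Bridge: rectangular translation designs ⟹ `CommutativeRealization` (CU13 Conjecture 21, ε-form)

Crux `CommutativeRealization` (stmt-MatrixMultiplication-9462) of route `CommutativeSchemes`, line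
`registered` (`Cruxes/CommutativeRealization/Lines/birth.lean`). This file is the KERNEL-CHECKED REDUCTION of
the crux to the line's single open stub, stated as a conditional theorem: if for every `ε > 0` some
TRANSLATION association scheme (classes invariant under simultaneous translation on a finite abelian group
`H`; Brouwer–Cohen–Neumaier §2.10) realises some rectangle `⟨l, m, n⟩`, `lmn ≥ 2`, with at most
`(lmn)^((2+ε)/3)` class labels (this hypothesis is Cohn–Umans 2013 Conjecture 21 restricted to the host
family CU13 §6.2 singles out, with the shape relaxed — an OPEN CONJECTURE, deliberately kept as an explicit
hypothesis and not dressed as a fact), then `CommutativeRealization` holds. The proof is the composition of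
two tree theorems: translation schemes are commutative (`stub_translationScheme_isCommutative`, BCN §2.10)
and the cube of a commutative realisation (`stub_commutativeRealization_cube`, CU13 §4.2 + proof of Thm. 17
¶1), followed by the exponent bookkeeping `r' ≤ r³ ≤ ((lmn)^((2+ε)/3))³ = (lmn)^(2+ε)` and the unpacking of
the scheme structure into the route's inlined clauses.

References: H. Cohn, C. Umans, *Fast matrix multiplication using coherent configurations*, SODA 2013
(arXiv:1207.6528), Conj. 21, Thm. 17, §6.2; A. E. Brouwer, A. M. Cohen, A. Neumaier, *Distance-Regular
Graphs* (1989), §2.10.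
-/

-- `Summit.<Summit>.<Problem>`: for the single-conjunct summit the duplicate component is mandated.
set_option linter.dupNamespace false

namespace Summit.MatrixMultiplication.MatrixMultiplication.Theorems

open Literature.Combinatorics.AssociationSchemes
open Summit.MatrixMultiplication.MatrixMultiplication.Theses.CommutativeSchemes

/-- **Bridge (conditional result).** Rectangular translation designs at the cube-root exponent — for every
`ε > 0` a translation association scheme on some finite abelian group realising some `⟨l, m, n⟩`, `lmn ≥ 2`,
with at most `(lmn)^((2+ε)/3)` class labels (CU13 Conj. 21 restricted to translation schemes; OPEN, kept as
the explicit hypothesis `hA`) — imply the crux `CommutativeRealization` (CU13 Conjecture 21 in ε-form):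
the translation scheme is commutative (BCN §2.10), the direct product of its three rotations is a commutative
scheme on `H × H × H` with at most `r³ ≤ (lmn)^(2+ε)` labels realising `⟨N, N, N⟩`, `N = lmn ≥ 2`
(CU13 proof of Thm. 17, ¶1), and the scheme axioms unpack into the route's inlined clauses.
[cite: CohnUmans2013, Conj. 21, Thm. 17, §6.2] -/
theorem commutativeRealization_of_rectangularTranslationDesign
    (hA : ∀ ε : ℝ, 0 < ε → ∃ (H : Type) (_ : AddCommGroup H) (_ : Fintype H) (l m n r : ℕ)
      (S : AssociationScheme H (Fin r)),
      (∀ x y w : H, S.cls (x + w) (y + w) = S.cls x y) ∧ 2 ≤ l * m * n ∧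
        (r : ℝ) ≤ ((l * m * n : ℕ) : ℝ) ^ ((2 + ε) / 3) ∧ S.Realizes l m n) :
    CommutativeRealization := by
  intro ε hε
  obtain ⟨H, _instG, _instF, l, m, n, r, S, htrans, h2, hr, hreal⟩ := hA ε hε
  have hcomm : S.IsCommutative := stub_translationScheme_isCommutative H r S htrans
  obtain ⟨r', T, hr', hTcomm, hTreal⟩ := stub_commutativeRealization_cube H l m n r S hcomm hreal
  refine ⟨l * m * n, h2, H × H × H, inferInstance, r', T.cls, ?_, T.cls_eq_cls_self_iff,
    T.exists_transpose, T.isCommutative_iff.1 hTcomm, hTreal⟩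
  -- the count: `r' ≤ r³ ≤ ((lmn)^((2+ε)/3))³ = (lmn)^(2+ε)`
  have h0 : (0 : ℝ) ≤ ((l * m * n : ℕ) : ℝ) := Nat.cast_nonneg _
  have h1 : (r' : ℝ) ≤ (r : ℝ) ^ (3 : ℕ) := by exact_mod_cast hr'
  have h2' : (r : ℝ) ^ (3 : ℕ) ≤ (((l * m * n : ℕ) : ℝ) ^ ((2 + ε) / 3)) ^ (3 : ℕ) :=
    pow_le_pow_left₀ (Nat.cast_nonneg r) hr 3
  have h3 : (((l * m * n : ℕ) : ℝ) ^ ((2 + ε) / 3)) ^ (3 : ℕ) = ((l * m * n : ℕ) : ℝ) ^ (2 + ε) := by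
    rw [← Real.rpow_natCast, ← Real.rpow_mul h0]
    congr 1
    push_cast
    ring
  calc (r' : ℝ) ≤ (r : ℝ) ^ (3 : ℕ) := h1
    _ ≤ (((l * m * n : ℕ) : ℝ) ^ ((2 + ε) / 3)) ^ (3 : ℕ) := h2'
    _ = ((l * m * n : ℕ) : ℝ) ^ (2 + ε) := h3

end Summit.MatrixMultiplication.MatrixMultiplication.Theorems
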